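import Summits.AtomisticToContinuum.HydrodynamicLimit.Theorems.InformationPercolationEngineChaosClosesEulerPressureValueI
import HarnessLib

/-!
# Collisional pressure value in band (crux `ChaosClosesEuler`, stmt-AtomisticToContinuum-15141, line `Sketch`,
# stub `stub_pressureValueOfEnskog`) — helper J: the three Enskog-side estimates along a good orbit

WHAT. For a bounded continuous coefficient `a`, the in-band cutoff `gc` (`|gc·Y| ≤ C_gY`, `gc = 0` on `[η₀,∞)`)
and the clamped contact value `Ỹ` (`= Y` on `(0, η_Y]`, `η₀ ≤ η_Y`), `g̃(b) = gc(b) Ỹ(b) b`: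
`enskogSide_layer` (R3) `|RW_kl − RI_kl| ≤ C_gY (8π/5) η₀ K (ω(t+1) + 6Ar)`; `enskogSide_value` (R1) the exact
value rewrite `Σ_kl RI_kl − 2∫∫ gc(σ³ρ) p_ex tr a = ∫∫ Σ_kl a_kl σ³gcY (B_r(𝒯_kl) − (4π/3)ρ²θ δ_kl)`;
`enskogSide_split` (R2) `|∫∫ X − (8π/15) ∫∫ g̃(σ³ρ) Σ ã_kl P_kl| ≤ 120π A C_gY η₀ ∫₀ᵗ (N+1)⁻¹Σᵢ sqTail L vᵢ`.

References: S. Chapman, T. G. Cowling (1970) §16.4; H. van Beijeren, M. H. Ernst, Physica 68 (1973).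
-/

noncomputable section

namespace Summit.AtomisticToContinuum.HydrodynamicLimit.Theorems.ChaosClosesEulerPressureValue

open scoped BigOperators Topology Classical MeasureTheory ENNReal InnerProductSpace
open Filter Set MeasureTheory
open Literature.MathematicalPhysics.KineticTheory
open Literature.Analysis.FluidPDE
open Summit.AtomisticToContinuum.HydrodynamicLimit.Theorems.LocalSecondLawNegative
open Summit.AtomisticToContinuum.HydrodynamicLimit.Theorems.LocalSecondLawLedger
open Summit.AtomisticToContinuum.HydrodynamicLimit.Theorems.LocalSecondLawLedger.L
  (Mmom rhoC_eq_sum momC_apply_eq_sum momC_eq_sum kinC_eq_trace norm_sq_eq_sum)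

/-- The truncated stress mark `𝒯[L,k,l]` (local notation for an explicit lambda). -/
local notation3 "𝒯[" L ", " k ", " l "]" => fun q : V3 × V3 × V3 =>
  min |⟪q.2.1 - q.2.2, q.1⟫_ℝ| (4 * L) * (speedCutoff L ‖q.2.1‖ * speedCutoff L ‖q.2.2‖) * (clip1 (q.1 k) * clip1 (q.1 l))

/-- The dominating mark `ℬ[L]` (local notation for an explicit lambda). -/
local notation3 "ℬ[" L "]" => fun q : V3 × V3 × V3 => 4 * L * (speedCutoff L ‖q.2.1‖ * speedCutoff L ‖q.2.2‖)

section EnskogEstimates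

open Function
open Summit.AtomisticToContinuum.HydrodynamicLimit.Theorems.ChaosClosesEulerStressIsotropy

variable {σ : ℝ} {N : ℕ} (Φ : HardSphereFlow (Torus.geometry (Fin 3)) (hsDiameter σ N) (N + 1)) {z : Phase N}

/-! ## §1 (R3) The layer estimate for the Enskog window -/

/-- **(R3)** `|σ³∫_{[0,t+1]}∫ ã_kl F₁ − σ³∫_{[0,t]}∫ a_kl F₁| ≤ C_gY (8π/5) η₀ K (ω (t+1) + 6 A r)`. [folklore] -/
theorem enskogSide_layer (hz : z ∈ Φ.good) (hσ : 0 < σ) {r L : ℝ} (hr : 0 < r) (hr2 : r < 1 / 2) (hL : 0 < L)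
    {t : ℝ} (ht : 0 ≤ t) {a : ℝ × T3 → ℝ} (ha : Continuous a) {A : ℝ} (hA : ∀ p, |a p| ≤ A) {ω : ℝ} (hω0 : 0 ≤ ω)
    (hω : ∀ (s t₀ : ℝ) (x x₀ : T3), |s - t₀| < r → Torus.euclidDist x x₀ < r → |a (t₀, x₀) - a (s, x)| ≤ ω)
    {gc : ℝ → ℝ} (hgc : Continuous gc) {CgY η₀ : ℝ} (hη₀ : 0 ≤ η₀) (hgY : ∀ b, 0 ≤ b → |gc b * contactValue b| ≤ CgY)
    (hg0 : ∀ b, η₀ ≤ b → gc b = 0) {K : ℝ} (hK : ke z ≤ K) (k l : Fin 3) :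
    |σ ^ 3 * (∫ s in Icc 0 (t + 1), ∫ x, (∫ t₀ in Icc 0 t, ∫ x₀,
        a (t₀, x₀) * (r⁻¹ * max (1 - |s - t₀| / r) 0 * cone r x x₀)) *
        (gc (σ ^ 3 * rhoC r (Φ.flow s z) x) * contactValue (σ ^ 3 * rhoC r (Φ.flow s z) x) *
          pairFunctional r 𝒯[L, k, l] (Φ.flow s z) x)) -
      σ ^ 3 * ∫ s in Icc 0 t, ∫ x, a (s, x) *
        (gc (σ ^ 3 * rhoC r (Φ.flow s z) x) * contactValue (σ ^ 3 * rhoC r (Φ.flow s z) x) *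
          pairFunctional r 𝒯[L, k, l] (Φ.flow s z) x)| ≤
      CgY * (8 * Real.pi / 5) * η₀ * K * (ω * (t + 1) + 6 * A * r) := by
  have hσ3 : 0 < σ ^ 3 := pow_pos hσ 3
  have hCgY : 0 ≤ CgY := (abs_nonneg _).trans (hgY 0 le_rfl)
  have hKz : 0 ≤ ke z := ke_nonneg z
  have hB₁ : ∀ s, ∫ x, |gc (σ ^ 3 * rhoC r (Φ.flow s z) x) * contactValue (σ ^ 3 * rhoC r (Φ.flow s z) x) *
      pairFunctional r 𝒯[L, k, l] (Φ.flow s z) x| ≤ CgY * (8 * Real.pi / 5) * (η₀ / σ ^ 3) * K := fun s =>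
    (integral_abs_F1_le Φ hz hσ hr hr2 hL hgc hη₀ hgY hg0 k l s).trans
      (mul_le_mul_of_nonneg_left hK (by positivity))
  have h := abs_windowSide_sub_instSide_le ha hA hr hr2 ht hω0 hω (measurable_F1 Φ hz hgc r L k l)
    (abs_F1_le Φ hσ.le hr hL hgY k l) hB₁
  rw [← mul_sub, abs_mul, abs_of_pos hσ3]
  calc σ ^ 3 * _ ≤ σ ^ 3 * (CgY * (8 * Real.pi / 5) * (η₀ / σ ^ 3) * K * (ω * (t + 1) + 6 * A * r)) :=
        mul_le_mul_of_nonneg_left h hσ3.le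
    _ = CgY * (8 * Real.pi / 5) * η₀ * K * (ω * (t + 1) + 6 * A * r) := by field_simp

/-! ## §2 (R1) The exact value rewrite -/

/-- The value integrand `X = Σ_kl a_kl W′ (B_r(𝒯_kl) − (4π/3)ρ²θδ_kl)` along a good orbit is jointly measurable and
bounded. [folklore] -/
theorem valueIntegrand_measurable_bdd (hz : z ∈ Φ.good) (hσ : 0 ≤ σ) {r L : ℝ} (hr : 0 < r) (hL : 0 < L)
    (a : Fin 3 → Fin 3 → ℝ × T3 → ℝ) (ha : ∀ k l, Continuous (a k l)) {A : ℝ} (hA : ∀ k l p, |a k l p| ≤ A)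
    {gc : ℝ → ℝ} (hgc : Continuous gc) {CgY : ℝ} (hgY : ∀ b, 0 ≤ b → |gc b * contactValue b| ≤ CgY) :
    Measurable (uncurry fun (s : ℝ) (x : T3) => ∑ k : Fin 3, ∑ l : Fin 3, a k l (s, x) *
      (σ ^ 3 * (gc (σ ^ 3 * rhoC r (Φ.flow s z) x) * contactValue (σ ^ 3 * rhoC r (Φ.flow s z) x)) *
        (pairFunctional r 𝒯[L, k, l] (Φ.flow s z) x -
          4 * Real.pi / 3 * (rhoC r (Φ.flow s z) x ^ 2 * thetaC r (Φ.flow s z) x) * (if k = l then 1 else 0)))) ∧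
    ∃ C : ℝ, ∀ s x, |∑ k : Fin 3, ∑ l : Fin 3, a k l (s, x) *
      (σ ^ 3 * (gc (σ ^ 3 * rhoC r (Φ.flow s z) x) * contactValue (σ ^ 3 * rhoC r (Φ.flow s z) x)) *
        (pairFunctional r 𝒯[L, k, l] (Φ.flow s z) x -
          4 * Real.pi / 3 * (rhoC r (Φ.flow s z) x ^ 2 * thetaC r (Φ.flow s z) x) * (if k = l then 1 else 0)))| ≤ C := by
  have hγ := measurable_flow_of_mem_good Φ hz
  have hρ : Measurable fun p : ℝ × T3 => σ ^ 3 * rhoC r (Φ.flow p.1 z) p.2 :=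
    measurable_const.mul (ChaosClosesEulerReduction.measurable_rhoC_orbit hγ r)
  have hW : Measurable fun p : ℝ × T3 => σ ^ 3 * (gc (σ ^ 3 * rhoC r (Φ.flow p.1 z) p.2) *
      contactValue (σ ^ 3 * rhoC r (Φ.flow p.1 z) p.2)) :=
    measurable_const.mul ((hgc.measurable.comp hρ).mul (EvenStressEnskog.measurable_contactValue.comp hρ))
  have hρθ := rhoSqTheta_measurable_mem Φ hz hr
  refine ⟨Finset.measurable_sum _ fun k _ => Finset.measurable_sum _ fun l _ =>
    ((ha k l).measurable.comp measurable_id).mul (hW.mul ((measurable_pairFunctional_orbit Φ hz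
      (continuous_sphereMark_markT L k l) r).sub ((hρθ.1.const_mul _).mul_const _))), ?_⟩
  have hA0 : 0 ≤ A := (abs_nonneg _).trans (hA 0 0 (0, 0))
  set CB := (3 / (Real.pi * r ^ 3)) ^ 2 * (32 * Real.pi / 5 * L ^ 2) with hCB
  set Cθ := 3 / (Real.pi * r ^ 3) * (2 / 3 * (3 / (Real.pi * r ^ 3) * ke z)) with hCθ
  refine ⟨9 * (A * (σ ^ 3 * CgY * (CB + 4 * Real.pi / 3 * Cθ))), fun s x => ?_⟩
  have hb : 0 ≤ σ ^ 3 * rhoC r (Φ.flow s z) x := mul_nonneg (pow_nonneg hσ 3) (rhoC_nonneg hr _ _)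
  have hCgY : 0 ≤ CgY := (abs_nonneg _).trans (hgY _ hb)
  have hterm : ∀ k l, |a k l (s, x) * (σ ^ 3 * (gc (σ ^ 3 * rhoC r (Φ.flow s z) x) *
      contactValue (σ ^ 3 * rhoC r (Φ.flow s z) x)) * (pairFunctional r 𝒯[L, k, l] (Φ.flow s z) x -
        4 * Real.pi / 3 * (rhoC r (Φ.flow s z) x ^ 2 * thetaC r (Φ.flow s z) x) * (if k = l then 1 else 0)))| ≤
      A * (σ ^ 3 * CgY * (CB + 4 * Real.pi / 3 * Cθ)) := by
    intro k l
    rw [abs_mul, abs_mul, abs_mul, abs_of_nonneg (pow_nonneg hσ 3)]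
    have h1 : σ ^ 3 * |gc (σ ^ 3 * rhoC r (Φ.flow s z) x) * contactValue (σ ^ 3 * rhoC r (Φ.flow s z) x)| ≤
        σ ^ 3 * CgY := mul_le_mul_of_nonneg_left (hgY _ hb) (pow_nonneg hσ 3)
    have h2 : |pairFunctional r 𝒯[L, k, l] (Φ.flow s z) x -
        4 * Real.pi / 3 * (rhoC r (Φ.flow s z) x ^ 2 * thetaC r (Φ.flow s z) x) * (if k = l then 1 else 0)| ≤
        CB + 4 * Real.pi / 3 * Cθ := by
      refine (abs_sub _ _).trans (add_le_add (abs_pairFunctional_markT_le_const hL hr _ x k l) ?_)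
      rw [abs_mul, abs_mul, abs_of_nonneg (by positivity : (0 : ℝ) ≤ 4 * Real.pi / 3), abs_of_nonneg (hρθ.2 s x).1]
      calc 4 * Real.pi / 3 * (rhoC r (Φ.flow s z) x ^ 2 * thetaC r (Φ.flow s z) x) * |(if k = l then (1 : ℝ) else 0)|
          ≤ 4 * Real.pi / 3 * Cθ * 1 := by
            refine mul_le_mul (mul_le_mul_of_nonneg_left (hρθ.2 s x).2 (by positivity)) ?_ (abs_nonneg _)
              (mul_nonneg (by positivity) (((hρθ.2 s x).1).trans (hρθ.2 s x).2))
            split_ifs <;> simp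
        _ = 4 * Real.pi / 3 * Cθ := mul_one _
    exact mul_le_mul (hA k l _) (mul_le_mul h1 h2 (abs_nonneg _) (mul_nonneg (pow_nonneg hσ 3) hCgY)) (by positivity) hA0
  calc _ ≤ ∑ k : Fin 3, ∑ l : Fin 3, |a k l (s, x) * (σ ^ 3 * (gc (σ ^ 3 * rhoC r (Φ.flow s z) x) *
        contactValue (σ ^ 3 * rhoC r (Φ.flow s z) x)) * (pairFunctional r 𝒯[L, k, l] (Φ.flow s z) x -
          4 * Real.pi / 3 * (rhoC r (Φ.flow s z) x ^ 2 * thetaC r (Φ.flow s z) x) * (if k = l then 1 else 0)))| :=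
        (Finset.abs_sum_le_sum_abs _ _).trans (Finset.sum_le_sum fun k _ => Finset.abs_sum_le_sum_abs _ _)
    _ ≤ ∑ _k : Fin 3, ∑ _l : Fin 3, A * (σ ^ 3 * CgY * (CB + 4 * Real.pi / 3 * Cθ)) :=
        Finset.sum_le_sum fun k _ => Finset.sum_le_sum fun l _ => hterm k l
    _ = 9 * (A * (σ ^ 3 * CgY * (CB + 4 * Real.pi / 3 * Cθ))) := by
        simp only [Finset.sum_const, Finset.card_univ, Fintype.card_fin, nsmul_eq_mul]; push_cast; ring

/-- **(R1) The exact value rewrite**: `Σ_kl σ³∫∫ a_kl F₁ − 2∫∫ gc(σ³ρ) p_ex tr a = ∫∫ X` (`0 < r < 1/2`, `0 ≤ σ`,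
`0 < L`). [folklore] -/
theorem enskogSide_value (hz : z ∈ Φ.good) (hσ : 0 ≤ σ) {r L : ℝ} (hr : 0 < r) (hL : 0 < L) (t : ℝ)
    (a : Fin 3 → Fin 3 → ℝ × T3 → ℝ) (ha : ∀ k l, Continuous (a k l)) {A : ℝ} (hA : ∀ k l p, |a k l p| ≤ A)
    {gc : ℝ → ℝ} (hgc : Continuous gc) {CgY : ℝ} (hgY : ∀ b, 0 ≤ b → |gc b * contactValue b| ≤ CgY) :
    (∑ k : Fin 3, ∑ l : Fin 3, σ ^ 3 * ∫ s in Icc 0 t, ∫ x, a k l (s, x) *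
        (gc (σ ^ 3 * rhoC r (Φ.flow s z) x) * contactValue (σ ^ 3 * rhoC r (Φ.flow s z) x) *
          pairFunctional r 𝒯[L, k, l] (Φ.flow s z) x)) -
      2 * ∫ s in Icc 0 t, ∫ x, gc (σ ^ 3 * rhoC r (Φ.flow s z) x) * pexC σ r (Φ.flow s z) x *
        ∑ k : Fin 3, a k k (s, x) =
    ∫ s in Icc 0 t, ∫ x, ∑ k : Fin 3, ∑ l : Fin 3, a k l (s, x) *
      (σ ^ 3 * (gc (σ ^ 3 * rhoC r (Φ.flow s z) x) * contactValue (σ ^ 3 * rhoC r (Φ.flow s z) x)) *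
        (pairFunctional r 𝒯[L, k, l] (Φ.flow s z) x -
          4 * Real.pi / 3 * (rhoC r (Φ.flow s z) x ^ 2 * thetaC r (Φ.flow s z) x) * (if k = l then 1 else 0))) := by
  have hγ := measurable_flow_of_mem_good Φ hz
  have hA0 : 0 ≤ A := (abs_nonneg _).trans (hA 0 0 (0, 0))
  have hρm : Measurable fun p : ℝ × T3 => σ ^ 3 * rhoC r (Φ.flow p.1 z) p.2 :=
    measurable_const.mul (ChaosClosesEulerReduction.measurable_rhoC_orbit hγ r)
  have hW : Measurable fun p : ℝ × T3 => gc (σ ^ 3 * rhoC r (Φ.flow p.1 z) p.2) *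
      contactValue (σ ^ 3 * rhoC r (Φ.flow p.1 z) p.2) := (hgc.measurable.comp hρm).mul (EvenStressEnskog.measurable_contactValue.comp hρm)
  have hρθ := rhoSqTheta_measurable_mem Φ hz hr
  set CB := (3 / (Real.pi * r ^ 3)) ^ 2 * (32 * Real.pi / 5 * L ^ 2) with hCB
  set Cθ := 3 / (Real.pi * r ^ 3) * (2 / 3 * (3 / (Real.pi * r ^ 3) * ke z)) with hCθ
  set P : Fin 3 → Fin 3 → ℝ → T3 → ℝ := fun k l s x => a k l (s, x) * (σ ^ 3 *
    (gc (σ ^ 3 * rhoC r (Φ.flow s z) x) * contactValue (σ ^ 3 * rhoC r (Φ.flow s z) x) *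
      pairFunctional r 𝒯[L, k, l] (Φ.flow s z) x)) with hP
  have hPm : ∀ k l, Measurable (uncurry (P k l)) := fun k l =>
    ((ha k l).measurable.comp measurable_id).mul ((measurable_F1 Φ hz hgc r L k l (σ := σ)).const_mul _)
  have hPb : ∀ k l s x, |P k l s x| ≤ A * (σ ^ 3 * (CgY * CB)) := fun k l s x => by
    simp only [hP]
    rw [abs_mul, abs_mul, abs_of_nonneg (pow_nonneg hσ 3)]
    exact mul_le_mul (hA k l _) (mul_le_mul_of_nonneg_left (abs_F1_le Φ hσ hr hL hgY k l s x) (pow_nonneg hσ 3))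
      (by positivity) hA0
  set Q : Fin 3 → Fin 3 → ℝ → T3 → ℝ := fun k l s x => a k l (s, x) * (σ ^ 3 *
    (gc (σ ^ 3 * rhoC r (Φ.flow s z) x) * contactValue (σ ^ 3 * rhoC r (Φ.flow s z) x)) *
      (4 * Real.pi / 3 * (rhoC r (Φ.flow s z) x ^ 2 * thetaC r (Φ.flow s z) x) * (if k = l then 1 else 0))) with hQ
  have hQm : ∀ k l, Measurable (uncurry (Q k l)) := fun k l =>
    ((ha k l).measurable.comp measurable_id).mul ((hW.const_mul _).mul ((hρθ.1.const_mul _).mul_const _))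
  have hQb : ∀ k l s x, |Q k l s x| ≤ A * (σ ^ 3 * CgY * (4 * Real.pi / 3 * Cθ)) := by
    intro k l s x
    have hb : 0 ≤ σ ^ 3 * rhoC r (Φ.flow s z) x := mul_nonneg (pow_nonneg hσ 3) (rhoC_nonneg hr _ _)
    have hCgY : 0 ≤ CgY := (abs_nonneg _).trans (hgY _ hb)
    simp only [hQ]
    rw [abs_mul, abs_mul, abs_mul, abs_of_nonneg (pow_nonneg hσ 3)]
    have h1 : σ ^ 3 * |gc (σ ^ 3 * rhoC r (Φ.flow s z) x) * contactValue (σ ^ 3 * rhoC r (Φ.flow s z) x)| ≤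
        σ ^ 3 * CgY := mul_le_mul_of_nonneg_left (hgY _ hb) (pow_nonneg hσ 3)
    have h2 : |4 * Real.pi / 3 * (rhoC r (Φ.flow s z) x ^ 2 * thetaC r (Φ.flow s z) x) * (if k = l then 1 else 0)| ≤
        4 * Real.pi / 3 * Cθ := by
      rw [abs_mul, abs_mul, abs_of_nonneg (by positivity : (0 : ℝ) ≤ 4 * Real.pi / 3), abs_of_nonneg (hρθ.2 s x).1]
      calc 4 * Real.pi / 3 * (rhoC r (Φ.flow s z) x ^ 2 * thetaC r (Φ.flow s z) x) * |(if k = l then (1 : ℝ) else 0)|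
          ≤ 4 * Real.pi / 3 * Cθ * 1 := by
            refine mul_le_mul (mul_le_mul_of_nonneg_left (hρθ.2 s x).2 (by positivity)) ?_ (abs_nonneg _)
              (mul_nonneg (by positivity) (((hρθ.2 s x).1).trans (hρθ.2 s x).2))
            split_ifs <;> simp
        _ = 4 * Real.pi / 3 * Cθ := mul_one _
    exact mul_le_mul (hA k l _) (mul_le_mul h1 h2 (abs_nonneg _) (mul_nonneg (pow_nonneg hσ 3) hCgY)) (by positivity) hA0
  have h1 : (∑ k : Fin 3, ∑ l : Fin 3, σ ^ 3 * ∫ s in Icc 0 t, ∫ x, a k l (s, x) *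
      (gc (σ ^ 3 * rhoC r (Φ.flow s z) x) * contactValue (σ ^ 3 * rhoC r (Φ.flow s z) x) *
        pairFunctional r 𝒯[L, k, l] (Φ.flow s z) x)) = ∫ s in Icc 0 t, ∫ x, ∑ k : Fin 3, ∑ l : Fin 3, P k l s x := by
    have hrowm : ∀ k, Measurable (uncurry fun s x => ∑ l : Fin 3, P k l s x) := fun k => by
      have h := Finset.measurable_sum Finset.univ fun l (_ : l ∈ Finset.univ) => hPm k l
      exact h
    have hrowb : ∀ k s x, |∑ l : Fin 3, P k l s x| ≤ 3 * (A * (σ ^ 3 * (CgY * CB))) := fun k s x =>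
      (Finset.abs_sum_le_sum_abs _ _).trans ((Finset.sum_le_sum fun l _ => hPb k l s x).trans (by
        simp only [Finset.sum_const, Finset.card_univ, Fintype.card_fin, nsmul_eq_mul]; push_cast; exact le_rfl))
    rw [setIntegral_integral_finsetSum Finset.univ (F := fun k s x => ∑ l : Fin 3, P k l s x) (fun k _ => hrowm k)
      (C := fun _ => 3 * (A * (σ ^ 3 * (CgY * CB)))) (fun k _ s x => hrowb k s x)]
    refine Finset.sum_congr rfl fun k _ => ?_
    rw [setIntegral_integral_finsetSum Finset.univ (F := fun l s x => P k l s x) (fun l _ => hPm k l)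
      (C := fun _ => A * (σ ^ 3 * (CgY * CB))) (fun l _ s x => hPb k l s x)]
    refine Finset.sum_congr rfl fun l _ => ?_
    rw [← setIntegral_integral_const_mul]
    refine integral_congr_ae (ae_of_all _ fun s => integral_congr_ae (ae_of_all _ fun x => ?_))
    simp only [hP]; ring
  have h2 : 2 * ∫ s in Icc 0 t, ∫ x, gc (σ ^ 3 * rhoC r (Φ.flow s z) x) * pexC σ r (Φ.flow s z) x *
      ∑ k : Fin 3, a k k (s, x) = ∫ s in Icc 0 t, ∫ x, ∑ k : Fin 3, ∑ l : Fin 3, Q k l s x := by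
    rw [← setIntegral_integral_const_mul]
    refine integral_congr_ae (ae_of_all _ fun s => integral_congr_ae (ae_of_all _ fun x => ?_))
    simp only [hQ]
    have e1 : ∑ k : Fin 3, ∑ l : Fin 3, a k l (s, x) * (σ ^ 3 *
        (gc (σ ^ 3 * rhoC r (Φ.flow s z) x) * contactValue (σ ^ 3 * rhoC r (Φ.flow s z) x)) *
          (4 * Real.pi / 3 * (rhoC r (Φ.flow s z) x ^ 2 * thetaC r (Φ.flow s z) x) * (if k = l then 1 else 0))) =
        ∑ k : Fin 3, ∑ l : Fin 3, a k l (s, x) * (if k = l then σ ^ 3 *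
          (gc (σ ^ 3 * rhoC r (Φ.flow s z) x) * contactValue (σ ^ 3 * rhoC r (Φ.flow s z) x)) *
            (4 * Real.pi / 3 * (rhoC r (Φ.flow s z) x ^ 2 * thetaC r (Φ.flow s z) x)) else 0) :=
      Finset.sum_congr rfl fun k _ => Finset.sum_congr rfl fun l _ => by split_ifs <;> ring
    rw [e1, sum_sum_mul_ite]
    have e2 := two_mul_pexC_eq σ r (Φ.flow s z) x
    calc 2 * (gc (σ ^ 3 * rhoC r (Φ.flow s z) x) * pexC σ r (Φ.flow s z) x * ∑ k : Fin 3, a k k (s, x))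
        = gc (σ ^ 3 * rhoC r (Φ.flow s z) x) * (2 * pexC σ r (Φ.flow s z) x) * ∑ k : Fin 3, a k k (s, x) := by ring
      _ = _ := by rw [e2]; ring
  have hPsm : Measurable (uncurry fun s x => ∑ k : Fin 3, ∑ l : Fin 3, P k l s x) := by
    have h := Finset.measurable_sum Finset.univ fun k (_ : k ∈ Finset.univ) =>
      Finset.measurable_sum Finset.univ fun l (_ : l ∈ Finset.univ) => hPm k l
    exact h
  have hPsb : ∀ s x, |∑ k : Fin 3, ∑ l : Fin 3, P k l s x| ≤ 9 * (A * (σ ^ 3 * (CgY * CB))) := fun s x =>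
    (Finset.abs_sum_le_sum_abs _ _).trans
      ((Finset.sum_le_sum fun k _ => (Finset.abs_sum_le_sum_abs _ _).trans (Finset.sum_le_sum fun l _ => hPb k l s x)).trans
        (by simp only [Finset.sum_const, Finset.card_univ, Fintype.card_fin, nsmul_eq_mul]; push_cast; nlinarith))
  have hQsm : Measurable (uncurry fun s x => ∑ k : Fin 3, ∑ l : Fin 3, Q k l s x) := by
    have h := Finset.measurable_sum Finset.univ fun k (_ : k ∈ Finset.univ) =>
      Finset.measurable_sum Finset.univ fun l (_ : l ∈ Finset.univ) => hQm k l
    exact h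
  have hQsb : ∀ s x, |∑ k : Fin 3, ∑ l : Fin 3, Q k l s x| ≤ 9 * (A * (σ ^ 3 * CgY * (4 * Real.pi / 3 * Cθ))) := fun s x =>
    (Finset.abs_sum_le_sum_abs _ _).trans
      ((Finset.sum_le_sum fun k _ => (Finset.abs_sum_le_sum_abs _ _).trans (Finset.sum_le_sum fun l _ => hQb k l s x)).trans
        (by simp only [Finset.sum_const, Finset.card_univ, Fintype.card_fin, nsmul_eq_mul]; push_cast; nlinarith))
  rw [h1, h2, ← setIntegral_integral_sub hPsm hPsb hQsm hQsb]
  refine integral_congr_ae (ae_of_all _ fun s => integral_congr_ae (ae_of_all _ fun x => ?_))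
  dsimp only
  rw [← Finset.sum_sub_distrib]
  refine Finset.sum_congr rfl fun k _ => ?_
  rw [← Finset.sum_sub_distrib]
  refine Finset.sum_congr rfl fun l _ => ?_
  simp only [hP, hQ]; ring

/-! ## §3 (R2) The deviatoric split, integrated -/

/-- The in-band weight `g̃(b) = gc(b) Ỹ(b) b` satisfies `|g̃(b)| ≤ C_gY η₀` on `[0, ∞)` and `g̃(b) = gc(b) Y(b) b` there.
[folklore] -/
theorem weight_facts {gc Yt : ℝ → ℝ} {CgY η₀ ηY : ℝ} (hη₀ : 0 < η₀)
    (hgY : ∀ b, 0 ≤ b → |gc b * contactValue b| ≤ CgY) (hg0 : ∀ b, η₀ ≤ b → gc b = 0)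
    (hYeq : ∀ b, 0 < b → b ≤ ηY → Yt b = contactValue b) (hle : η₀ ≤ ηY) {b : ℝ} (hb : 0 ≤ b) :
    gc b * contactValue b * b = gc b * Yt b * b ∧ |gc b * contactValue b * b| ≤ CgY * η₀ := by
  refine ⟨EvenStressEnskog.mul_contactValue_mul_eq_weight hYeq hle hg0 hb, ?_⟩
  have hCgY : 0 ≤ CgY := (abs_nonneg _).trans (hgY b hb)
  by_cases hband : η₀ ≤ b
  · rw [hg0 b hband, zero_mul, zero_mul, abs_zero]; positivity
  · push Not at hband
    rw [abs_mul, abs_of_nonneg hb]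
    exact mul_le_mul (hgY b hb) hband.le hb hCgY

/-- **(R2) The deviatoric split, integrated along a good orbit**:
`|∫∫ X − (8π/15) ∫∫ g̃(σ³ρ_r) Σ ã_kl P_kl| ≤ 120π A C_gY η₀ ∫₀ᵗ (N+1)⁻¹ Σᵢ sqTail L vᵢ(s) ds`. [folklore] -/
theorem enskogSide_split (hz : z ∈ Φ.good) (hσ : 0 < σ) {r L : ℝ} (hr : 0 < r) (hr2 : r < 1 / 2) (hL : 0 < L)
    (t : ℝ) (a : Fin 3 → Fin 3 → ℝ × T3 → ℝ) (ha : ∀ k l, Continuous (a k l)) {A : ℝ} (hA : ∀ k l p, |a k l p| ≤ A)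
    {gc Yt : ℝ → ℝ} (hgc : Continuous gc) (hYt : Continuous Yt) {CgY η₀ ηY : ℝ} (hη₀ : 0 < η₀)
    (hgY : ∀ b, 0 ≤ b → |gc b * contactValue b| ≤ CgY) (hg0 : ∀ b, η₀ ≤ b → gc b = 0)
    (hYeq : ∀ b, 0 < b → b ≤ ηY → Yt b = contactValue b) (hle : η₀ ≤ ηY) :
    |(∫ s in Icc 0 t, ∫ x, ∑ k : Fin 3, ∑ l : Fin 3, a k l (s, x) *
        (σ ^ 3 * (gc (σ ^ 3 * rhoC r (Φ.flow s z) x) * contactValue (σ ^ 3 * rhoC r (Φ.flow s z) x)) *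
          (pairFunctional r 𝒯[L, k, l] (Φ.flow s z) x -
            4 * Real.pi / 3 * (rhoC r (Φ.flow s z) x ^ 2 * thetaC r (Φ.flow s z) x) * (if k = l then 1 else 0)))) -
      8 * Real.pi / 15 * ∫ s in Icc 0 t, ∫ x,
        (gc (σ ^ 3 * rhoC r (Φ.flow s z) x) * Yt (σ ^ 3 * rhoC r (Φ.flow s z) x) * (σ ^ 3 * rhoC r (Φ.flow s z) x)) *
        ∑ k : Fin 3, ∑ l : Fin 3, (a k l (s, x) - (∑ j : Fin 3, a j j (s, x)) / 3 * (if k = l then 1 else 0)) *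
          (MpsiC r (Φ.flow s z) x (fun v => v k * v l) -
            momC r (Φ.flow s z) x k * momC r (Φ.flow s z) x l / rhoC r (Φ.flow s z) x)| ≤
      120 * Real.pi * A * CgY * η₀ * ∫ s in Icc 0 t, ((N + 1 : ℕ) : ℝ)⁻¹ * ∑ i, sqTail L ((Φ.flow s z) i).2 := by
  have hγ := measurable_flow_of_mem_good Φ hz
  have hA0 : 0 ≤ A := (abs_nonneg _).trans (hA 0 0 (0, 0))
  have hCgY : 0 ≤ CgY := (abs_nonneg _).trans (hgY 0 le_rfl)
  have hσ3 : 0 ≤ σ ^ 3 := pow_nonneg hσ.le 3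
  obtain ⟨hXm, CX, hXb⟩ := valueIntegrand_measurable_bdd Φ hz hσ.le hr hL a ha hA hgc hgY
  have hρm : Measurable fun p : ℝ × T3 => σ ^ 3 * rhoC r (Φ.flow p.1 z) p.2 :=
    measurable_const.mul (ChaosClosesEulerReduction.measurable_rhoC_orbit hγ r)
  have hgt : Continuous fun b => gc b * Yt b * b := (hgc.mul hYt).mul continuous_id
  have hP := fun k l => Pfield_measurable_le Φ hz hr k l
  have hatr : ∀ k l, Continuous fun p : ℝ × T3 => a k l p - (∑ j : Fin 3, a j j p) / 3 * (if k = l then (1 : ℝ) else 0) :=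
    fun k l => (ha k l).sub (((continuous_finsetSum _ fun j _ => ha j j).div_const 3).mul continuous_const)
  have hatrb : ∀ k l p, |a k l p - (∑ j : Fin 3, a j j p) / 3 * (if k = l then (1 : ℝ) else 0)| ≤ 2 * A := by
    intro k l p
    refine (abs_sub _ _).trans ?_
    have h1 : |(∑ j : Fin 3, a j j p) / 3 * (if k = l then (1 : ℝ) else 0)| ≤ A := by
      rw [abs_mul, abs_div, abs_of_pos (by norm_num : (0 : ℝ) < 3)]
      have hs : |∑ j : Fin 3, a j j p| ≤ 3 * A :=
        (Finset.abs_sum_le_sum_abs _ _).trans ((Finset.sum_le_sum fun j _ => hA j j p).trans (by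
          simp only [Finset.sum_const, Finset.card_univ, Fintype.card_fin, nsmul_eq_mul]; push_cast; exact le_rfl))
      have hδ : |(if k = l then (1 : ℝ) else 0)| ≤ 1 := by split_ifs <;> simp
      calc |∑ j : Fin 3, a j j p| / 3 * |(if k = l then (1 : ℝ) else 0)| ≤ 3 * A / 3 * 1 :=
            mul_le_mul (div_le_div_of_nonneg_right hs (by norm_num)) hδ (abs_nonneg _) (by positivity)
        _ = A := by ring
    linarith [hA k l p]
  set Wf : ℝ → T3 → ℝ := fun s x => (gc (σ ^ 3 * rhoC r (Φ.flow s z) x) * Yt (σ ^ 3 * rhoC r (Φ.flow s z) x) *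
      (σ ^ 3 * rhoC r (Φ.flow s z) x)) * ∑ k : Fin 3, ∑ l : Fin 3,
        (a k l (s, x) - (∑ j : Fin 3, a j j (s, x)) / 3 * (if k = l then 1 else 0)) *
          (MpsiC r (Φ.flow s z) x (fun v => v k * v l) -
            momC r (Φ.flow s z) x k * momC r (Φ.flow s z) x l / rhoC r (Φ.flow s z) x) with hWf
  have hWm : Measurable (uncurry Wf) := by
    have h := (hgt.measurable.comp hρm).mul (Finset.measurable_sum Finset.univ fun k (_ : k ∈ Finset.univ) =>
      Finset.measurable_sum Finset.univ fun l (_ : l ∈ Finset.univ) =>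
        ((hatr k l).measurable.comp measurable_id).mul (hP k l).1)
    exact h
  set CP := 10 / 3 * (3 / (Real.pi * r ^ 3) * ke z) with hCP
  have hWb : ∀ s x, |Wf s x| ≤ CgY * η₀ * (9 * (2 * A * CP)) := by
    intro s x
    have hb : 0 ≤ σ ^ 3 * rhoC r (Φ.flow s z) x := mul_nonneg hσ3 (rhoC_nonneg hr _ _)
    have hw := weight_facts hη₀ hgY hg0 hYeq hle hb
    simp only [hWf]
    rw [abs_mul, ← hw.1]
    have hterm : ∀ k l : Fin 3, |(a k l (s, x) - (∑ j : Fin 3, a j j (s, x)) / 3 * (if k = l then 1 else 0)) *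
        (MpsiC r (Φ.flow s z) x (fun v => v k * v l) -
          momC r (Φ.flow s z) x k * momC r (Φ.flow s z) x l / rhoC r (Φ.flow s z) x)| ≤ 2 * A * CP := by
      intro k l
      rw [abs_mul]; exact mul_le_mul (hatrb k l _) ((hP k l).2 s x) (abs_nonneg _) (by positivity)
    have hsum : |∑ k : Fin 3, ∑ l : Fin 3, (a k l (s, x) - (∑ j : Fin 3, a j j (s, x)) / 3 * (if k = l then 1 else 0)) *
        (MpsiC r (Φ.flow s z) x (fun v => v k * v l) -
          momC r (Φ.flow s z) x k * momC r (Φ.flow s z) x l / rhoC r (Φ.flow s z) x)| ≤ 9 * (2 * A * CP) := by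
      calc |∑ k : Fin 3, ∑ l : Fin 3, (a k l (s, x) - (∑ j : Fin 3, a j j (s, x)) / 3 * (if k = l then 1 else 0)) *
            (MpsiC r (Φ.flow s z) x (fun v => v k * v l) -
              momC r (Φ.flow s z) x k * momC r (Φ.flow s z) x l / rhoC r (Φ.flow s z) x)|
          ≤ ∑ k : Fin 3, ∑ l : Fin 3, |(a k l (s, x) - (∑ j : Fin 3, a j j (s, x)) / 3 * (if k = l then 1 else 0)) *
            (MpsiC r (Φ.flow s z) x (fun v => v k * v l) -
              momC r (Φ.flow s z) x k * momC r (Φ.flow s z) x l / rhoC r (Φ.flow s z) x)| :=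
            (Finset.abs_sum_le_sum_abs _ _).trans (Finset.sum_le_sum fun k _ => Finset.abs_sum_le_sum_abs _ _)
        _ ≤ ∑ _k : Fin 3, ∑ _l : Fin 3, 2 * A * CP := Finset.sum_le_sum fun k _ => Finset.sum_le_sum fun l _ => hterm k l
        _ = 9 * (2 * A * CP) := by
            simp only [Finset.sum_const, Finset.card_univ, Fintype.card_fin, nsmul_eq_mul]; push_cast; ring
    exact mul_le_mul hw.2 hsum (abs_nonneg _) (by positivity)
  obtain ⟨hTm, hTmem⟩ := tailField_measurable_mem Φ hz hr L
  have hGm : Measurable (uncurry fun s x => 120 * Real.pi * A * CgY * η₀ * MpsiC r (Φ.flow s z) x (sqTail L)) :=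
    hTm.const_mul _
  have hGb : ∀ s x, |120 * Real.pi * A * CgY * η₀ * MpsiC r (Φ.flow s z) x (sqTail L)| ≤
      120 * Real.pi * A * CgY * η₀ * (2 * (3 / (Real.pi * r ^ 3) * ke z)) := fun s x => by
    rw [abs_mul, abs_of_nonneg (by positivity : (0 : ℝ) ≤ 120 * Real.pi * A * CgY * η₀), abs_of_nonneg (hTmem s x).1]
    exact mul_le_mul_of_nonneg_left (hTmem s x).2 (by positivity)
  have hdom : ∀ s ∈ Icc (0 : ℝ) t, ∀ x, |(∑ k : Fin 3, ∑ l : Fin 3, a k l (s, x) *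
      (σ ^ 3 * (gc (σ ^ 3 * rhoC r (Φ.flow s z) x) * contactValue (σ ^ 3 * rhoC r (Φ.flow s z) x)) *
        (pairFunctional r 𝒯[L, k, l] (Φ.flow s z) x -
          4 * Real.pi / 3 * (rhoC r (Φ.flow s z) x ^ 2 * thetaC r (Φ.flow s z) x) * (if k = l then 1 else 0)))) -
      8 * Real.pi / 15 * Wf s x| ≤ 120 * Real.pi * A * CgY * η₀ * MpsiC r (Φ.flow s z) x (sqTail L) := by
    intro s _ x
    set w := Φ.flow s z with hw
    have hb : 0 ≤ σ ^ 3 * rhoC r w x := mul_nonneg hσ3 (rhoC_nonneg hr _ _)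
    have hwf := weight_facts hη₀ hgY hg0 hYeq hle hb
    set W := σ ^ 3 * (gc (σ ^ 3 * rhoC r w x) * contactValue (σ ^ 3 * rhoC r w x)) with hW
    have key := abs_weighted_sum_sub_le hL hr w x (fun k l => a k l (s, x)) (fun k l => hA k l (s, x)) W
    have hWρ : W * rhoC r w x = gc (σ ^ 3 * rhoC r w x) * Yt (σ ^ 3 * rhoC r w x) * (σ ^ 3 * rhoC r w x) := by
      rw [← hwf.1, hW]; ring
    have hWρb : |W| * rhoC r w x ≤ CgY * η₀ := by
      have h := hwf.2
      rw [show gc (σ ^ 3 * rhoC r w x) * contactValue (σ ^ 3 * rhoC r w x) * (σ ^ 3 * rhoC r w x) =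
        W * rhoC r w x by rw [hW]; ring, abs_mul, abs_of_nonneg (rhoC_nonneg hr _ _)] at h
      exact h
    have e : 8 * Real.pi / 15 * Wf s x = 8 * Real.pi / 15 * (W * rhoC r w x) * ∑ k : Fin 3, ∑ l : Fin 3,
        (a k l (s, x) - (∑ j : Fin 3, a j j (s, x)) / 3 * (if k = l then 1 else 0)) *
          (MpsiC r w x (fun v => v k * v l) - momC r w x k * momC r w x l / rhoC r w x) := by
      rw [hWf]; dsimp only; rw [hWρ]; ring
    rw [e]
    refine key.trans ?_
    have hTL := MpsiC_sqTail_nonneg hr w x L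
    calc 120 * Real.pi * A * |W| * (rhoC r w x * MpsiC r w x (sqTail L))
        = 120 * Real.pi * A * (|W| * rhoC r w x) * MpsiC r w x (sqTail L) := by ring
      _ ≤ 120 * Real.pi * A * (CgY * η₀) * MpsiC r w x (sqTail L) := by gcongr
      _ = _ := by ring
  rw [← setIntegral_integral_const_mul, ← setIntegral_integral_sub hXm hXb (hWm.const_mul _)
    (fun s x => by rw [abs_mul]; exact mul_le_mul_of_nonneg_left (hWb s x) (abs_nonneg _))]
  refine (abs_setIntegral_integral_le_of_le hGm hGb hdom).trans (le_of_eq ?_)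
  rw [setIntegral_integral_const_mul]
  congr 1
  refine integral_congr_ae (ae_of_all _ fun s => ?_)
  exact integral_tailField (Φ.flow s z) hr hr2 L

end EnskogEstimates

/-! ## Registered sub-goal -/

/-- **Registered sub-goal `stub_pressureValueJ` (helper J of `stub_pressureValueOfEnskog`): the in-band weight
`gc(b) Y(b) b` is bounded by `C_gY η₀` on `[0, ∞)`.** [folklore] -/
theorem stub_pressureValueJ : ∀ {gc Yt : ℝ → ℝ} {CgY η₀ ηY : ℝ}, 0 < η₀ → (∀ b, 0 ≤ b → |gc b * contactValue b| ≤ CgY) → (∀ b, η₀ ≤ b → gc b = 0) → (∀ b, 0 < b → b ≤ ηY → Yt b = contactValue b) → η₀ ≤ ηY → ∀ {b : ℝ}, 0 ≤ b → |gc b * contactValue b * b| ≤ CgY * η₀ :=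
  fun hη₀ hgY hg0 hYeq hle _ hb => (weight_facts hη₀ hgY hg0 hYeq hle hb).2

end Summit.AtomisticToContinuum.HydrodynamicLimit.Theorems.ChaosClosesEulerPressureValue

end
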